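import Summits.Ventures.QEC.Thresholds.CSSFamilyThresholds
import Literature.InformationTheory.QuantumCodes.OptimalDecodingMonotone
import HarnessLib

/-!
# The OPTIMAL (maximum-likelihood) accuracy threshold of a CSS code family: a decoder-free number, bounded below by
# every decoder family's certified threshold and above by the every-decoder ceilings, monotone in the rate
# (the toric-code instances `.0357 < p_c^opt ≤ 1/4`, `.0112 < p_c^{ph,opt} ≤ 1/4` are in `OptimalToricThresholds.lean`)

Venture QEC, `Summits/Ventures/QEC/Thresholds/` (LADDER-QEC rung Q5; qec-lit-2 gen 5). Packaging of
`Literature/…/MaximumLikelihoodDecoding.lean` (maximum-likelihood decoding is optimal: `Decoder.optimalFailureMass`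
is `≤` the failure mass of EVERY decoder and is attained) for the census vocabulary (`IsThresholdLowerBound`,
`accuracyThreshold`, the failure families of `CSSFamilyThresholds.lean`, `ToricCodeThresholds.lean`,
`ToricCodePhenomenologicalThresholds.lean`).

Dennis–Kitaev–Landahl–Preskill 2002 define the accuracy threshold `p_c` (§4.3, §4.6) for the OPTIMAL recovery ("the
optimal way to recover is to guess that the homology class … is the class with the highest probability") and then bound
it from BELOW by analysing minimum-weight recovery (§4.7: "the critical value of `p` at zero temperature provides a lower
bound on `p_c`", §5). Every certified threshold theorem of the cell so far is stated for a decoder FAMILY `D`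
(`zFailureFamily C D`, `toricFailureFamily D`, …). This file defines the decoder-free optimal families — rate by rate
the least failure probability over all decoders of that code — and proves:

* `zOptimalFailureFamily C ≤ zFailureFamily C D` pointwise for every `D` (and `x`, toric, phenomenological twins); hence
  every certified threshold LOWER bound `a ≤ 1` of any decoder family is one for the optimal family, and
  `accuracyThreshold (zFailureFamily C D) ≤ accuracyThreshold (zOptimalFailureFamily C)` — DKLP §4.7 as a theorem
  (`z_accuracyThreshold_le_optimal`, `x_accuracyThreshold_le_optimal`);
* the every-decoder CEILINGS hold for the optimal families: `k ≥ 1 ⇒ p₀^{Z,opt} + p₀^{X,opt} ≤ 1/2`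
  (`optimal_thresholds_add_le_half`), `≤ 1/2` each, and `y`-erasure comparison `2 p_c^{opt} ≤` … in the finite-size form
  `P^Z_{2p}[erasure uncorrectable] ≤ 2 · (optimal failure at p)`;
* **monotonicity / a threshold in the strict sense** (`BitFlipDegradation.lean`, `OptimalDecodingMonotone.lean`:
  the bit-flip family is ordered by degradation): the optimal families are non-decreasing in `p` on `[0, 1/2]`, so a
  rate below which SOME rate `p' ≤ 1/2` is below threshold is itself below threshold, and every below-threshold rate
  `p' ≤ 1/2` is `≤ accuracyThreshold` (`z_optimal_belowThreshold_of_le`, `z_optimal_le_accuracyThreshold_of_belowThreshold`)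
  — for the optimal decoder DKLP's `p_c` separates an initial segment of good rates from the rest
  (`CodeCapacityNoise.lean` design note (1));
* the toric-code instances (lattice DKLP objects; `.0357 < p_c^opt ≤ 1/4`, `.0112 < p_c^{ph,opt} ≤ 1/4`) are the
  companion file `OptimalToricThresholds.lean`.

HONEST FRAMING: theorem-only (plus two definitions of families); kernel axioms; no named fact; no `native_decide`.
The optimal family's decoder depends on `p` (it is an infimum over decoders taken rate by rate) — that is the printed
notion; a threshold for ONE `p`-independent decoder family is a lower bound for it, never conversely.

## References

* [DennisEtAl2002] E. Dennis, A. Kitaev, A. Landahl, J. Preskill, J. Math. Phys. 43 (2002) 4452, §4.3 eq. (prob_homol)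
  and the sentence after it; §4.6 (`p_c = .1094 ± .0002`); §4.7 ("provides a lower bound on `p_c`"); §5.3.
* [BravyiSucharaVargo2014] S. Bravyi, M. Suchara, A. Vargo, Phys. Rev. A 90 (2014) 032326, §1–§2 (MLD is optimal).
* [RichardsonUrbanke2008] T. Richardson, R. Urbanke, *Modern Coding Theory*, Lemma 4.78 (erasure decomposition).
-/

noncomputable section

namespace Summit.Ventures.QEC.Thresholds

open Filter Topology Finset Matrix
open Literature.InformationTheory.QuantumCodes

/-! ### Generic transfer: a pointwise smaller non-negative family inherits threshold lower bounds -/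

section Transfer

variable {P P' : ℕ → ℝ → ℝ}

/-- If `0 ≤ P i p ≤ P' i p` for all `i` and all `0 ≤ p ≤ 1`, every threshold lower bound `a ≤ 1` of `P'` is one of
`P` (squeeze). [cite: DennisEtAl2002, §4.7 (a lower bound on p_c)] -/
theorem isThresholdLowerBound_of_le (h0 : ∀ i p, 0 ≤ p → p ≤ 1 → 0 ≤ P i p)
    (hle : ∀ i p, 0 ≤ p → p ≤ 1 → P i p ≤ P' i p) {a : ℝ} (ha : IsThresholdLowerBound P' a) (ha1 : a ≤ 1) :
    IsThresholdLowerBound P a := fun p hp hpa =>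
  (ha p hp hpa).of_le (fun i => h0 i p hp (hpa.le.trans ha1)) fun i => hle i p hp (hpa.le.trans ha1)

/-- If `0 ≤ P ≤ P'` on `[0, 1]`, then `accuracyThreshold P' ≤ accuracyThreshold P`.
[cite: DennisEtAl2002, §4.7 (a lower bound on p_c)] -/
theorem accuracyThreshold_le_of_le (h0 : ∀ i p, 0 ≤ p → p ≤ 1 → 0 ≤ P i p)
    (hle : ∀ i p, 0 ≤ p → p ≤ 1 → P i p ≤ P' i p) : accuracyThreshold P' ≤ accuracyThreshold P :=
  le_accuracyThreshold
    (isThresholdLowerBound_of_le h0 hle (isThresholdLowerBound_accuracyThreshold P') (accuracyThreshold_le_one P'))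
    (accuracyThreshold_le_one P')

end Transfer

/-! ### CSS code families given as objects: the optimal sector families -/

section CSSFamilies

variable {RX RZ Q : ℕ → Type*} [∀ i, Fintype (Q i)] [∀ i, DecidableEq (Q i)]

/-- **Optimal `Z`-sector code-capacity family**: for the `i`-th code and rate `p`, the least failure probability over
ALL decoders of the `X`-syndrome under independent phase flips of rate `p` (attained by maximum-likelihood decoding).
[cite: DennisEtAl2002, §4.3 (the optimal way to recover) and §4.6 (p_c)] -/
def zOptimalFailureFamily [∀ i, Fintype (RZ i)] (C : ∀ i, CSSCode (RX i) (RZ i) (Q i)) : ℕ → ℝ → ℝ :=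
  fun i p => (C i).zOptimalFailure p

/-- **Optimal `X`-sector code-capacity family** (bit flips, `Z`-syndrome). [cite: DennisEtAl2002, §4.3 and §4.6 (p_c)] -/
def xOptimalFailureFamily [∀ i, Fintype (RX i)] (C : ∀ i, CSSCode (RX i) (RZ i) (Q i)) : ℕ → ℝ → ℝ :=
  fun i p => (C i).xOptimalFailure p

/-- The optimal `X`-family is the optimal `Z`-family of the exchanged codes (definitional).
[cite: DennisEtAl2002, §4.1 (separate procedures for X and Z errors)] -/
theorem xOptimalFailureFamily_eq_swap [∀ i, Fintype (RX i)] (C : ∀ i, CSSCode (RX i) (RZ i) (Q i)) :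
    xOptimalFailureFamily C = zOptimalFailureFamily (fun i => (C i).swap) := rfl

/-- **No decoder family beats the optimal family** (`Z`-sector, pointwise).
[cite: BravyiSucharaVargo2014, §1 (MLD is the optimal error correction algorithm)] -/
theorem zOptimalFailureFamily_le [∀ i, Fintype (RZ i)] (C : ∀ i, CSSCode (RX i) (RZ i) (Q i))
    (D : ∀ i, Decoder (RX i → ZMod 2) (Q i → ZMod 2)) (i : ℕ) (p : ℝ) :
    zOptimalFailureFamily C i p ≤ zFailureFamily C D i p :=
  (C i).zOptimalFailure_le (D i) p

/-- **No decoder family beats the optimal family** (`X`-sector, pointwise).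
[cite: BravyiSucharaVargo2014, §1 (MLD is the optimal error correction algorithm)] -/
theorem xOptimalFailureFamily_le [∀ i, Fintype (RX i)] (C : ∀ i, CSSCode (RX i) (RZ i) (Q i))
    (D : ∀ i, Decoder (RZ i → ZMod 2) (Q i → ZMod 2)) (i : ℕ) (p : ℝ) :
    xOptimalFailureFamily C i p ≤ xFailureFamily C D i p :=
  (C i).xOptimalFailure_le (D i) p

/-- **Every certified `Z`-threshold lower bound `a ≤ 1` of any decoder family is one for the optimal family.**
[cite: DennisEtAl2002, §4.7 (a lower bound on p_c)] -/
theorem z_optimal_isThresholdLowerBound_of [∀ i, Fintype (RZ i)] (C : ∀ i, CSSCode (RX i) (RZ i) (Q i))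
    (D : ∀ i, Decoder (RX i → ZMod 2) (Q i → ZMod 2)) {a : ℝ} (ha : IsThresholdLowerBound (zFailureFamily C D) a)
    (ha1 : a ≤ 1) : IsThresholdLowerBound (zOptimalFailureFamily C) a :=
  isThresholdLowerBound_of_le (fun i _ hp0 hp1 => (C i).zOptimalFailure_nonneg hp0 hp1)
    (fun i p _ _ => zOptimalFailureFamily_le C D i p) ha ha1

/-- **Every certified `X`-threshold lower bound `a ≤ 1` of any decoder family is one for the optimal family.**
[cite: DennisEtAl2002, §4.7 (a lower bound on p_c)] -/
theorem x_optimal_isThresholdLowerBound_of [∀ i, Fintype (RX i)] (C : ∀ i, CSSCode (RX i) (RZ i) (Q i))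
    (D : ∀ i, Decoder (RZ i → ZMod 2) (Q i → ZMod 2)) {a : ℝ} (ha : IsThresholdLowerBound (xFailureFamily C D) a)
    (ha1 : a ≤ 1) : IsThresholdLowerBound (xOptimalFailureFamily C) a :=
  isThresholdLowerBound_of_le (fun i _ hp0 hp1 => (C i).xOptimalFailure_nonneg hp0 hp1)
    (fun i p _ _ => xOptimalFailureFamily_le C D i p) ha ha1

/-- **DKLP §4.7 as a theorem** (`Z`-sector): the accuracy threshold of ANY decoder family is at most the optimal
accuracy threshold. [cite: DennisEtAl2002, §4.7 (provides a lower bound on p_c)] -/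
theorem z_accuracyThreshold_le_optimal [∀ i, Fintype (RZ i)] (C : ∀ i, CSSCode (RX i) (RZ i) (Q i))
    (D : ∀ i, Decoder (RX i → ZMod 2) (Q i → ZMod 2)) :
    accuracyThreshold (zFailureFamily C D) ≤ accuracyThreshold (zOptimalFailureFamily C) :=
  accuracyThreshold_le_of_le (fun i _ hp0 hp1 => (C i).zOptimalFailure_nonneg hp0 hp1)
    fun i p _ _ => zOptimalFailureFamily_le C D i p

/-- **DKLP §4.7 as a theorem** (`X`-sector). [cite: DennisEtAl2002, §4.7 (provides a lower bound on p_c)] -/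
theorem x_accuracyThreshold_le_optimal [∀ i, Fintype (RX i)] (C : ∀ i, CSSCode (RX i) (RZ i) (Q i))
    (D : ∀ i, Decoder (RZ i → ZMod 2) (Q i → ZMod 2)) :
    accuracyThreshold (xFailureFamily C D) ≤ accuracyThreshold (xOptimalFailureFamily C) :=
  accuracyThreshold_le_of_le (fun i _ hp0 hp1 => (C i).xOptimalFailure_nonneg hp0 hp1)
    fun i p _ _ => xOptimalFailureFamily_le C D i p

/-- **Optimal code-capacity threshold `≤ 1/2`** (`k ≥ 1`; at flip rate `1/2` even maximum-likelihood decoding fails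
with probability `≥ 1/2`). [cite: RichardsonUrbanke2008, Lemma 4.78 (Erasure Decomposition Lemma)] -/
theorem z_optimal_threshold_le_half [∀ i, Fintype (RX i)] [∀ i, Fintype (RZ i)]
    (C : ∀ i, CSSCode (RX i) (RZ i) (Q i)) (hk : ∀ i, 0 < (C i).k) {a : ℝ}
    (ha : IsThresholdLowerBound (zOptimalFailureFamily C) a) : a ≤ 1 / 2 := by
  by_contra h
  push Not at h
  refine not_belowThreshold_of_le (c := 1 / 2) (by norm_num) (fun i => ?_) (ha (1 / 2) (by norm_num) h)
  exact (C i).half_le_zOptimalFailure_half (hk i)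

/-- **THE CODE-CAPACITY CONVERSE FOR THE OPTIMAL DECODERS**: for every CSS family with `k ≥ 1`, certified lower bounds
`a` (optimal `Z`-sector) and `b` (optimal `X`-sector) satisfy `a + b ≤ 1/2`.
[cite: RichardsonUrbanke2008, Lemma 4.78; StaceBarrettDoherty2009, p. 2 (no-cloning bound)] -/
theorem optimal_thresholds_add_le_half [∀ i, Fintype (RX i)] [∀ i, Fintype (RZ i)]
    (C : ∀ i, CSSCode (RX i) (RZ i) (Q i)) (hk : ∀ i, 0 < (C i).k) {a b : ℝ}
    (ha : IsThresholdLowerBound (zOptimalFailureFamily C) a) (hb : IsThresholdLowerBound (xOptimalFailureFamily C) b) :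
    a + b ≤ 1 / 2 := by
  by_contra h
  push Not at h
  -- pick a rate `0 ≤ p < a` with `1/2 - p < b`
  have hb' : b ≤ 1 / 2 := by
    by_contra hb2
    push Not at hb2
    refine not_belowThreshold_of_le (c := 1 / 2) (by norm_num) (fun i => ?_) (hb (1 / 2) (by norm_num) hb2)
    exact (C i).half_le_xOptimalFailure_half (hk i)
  have ha' : a ≤ 1 / 2 := z_optimal_threshold_le_half C hk ha
  -- the rate p := max 0 (1/2 - b) + ε-free choice: take p with max(0, 1/2 - b) < p < a; use the midpoint
  set p : ℝ := (max 0 (1 / 2 - b) + a) / 2 with hp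
  have hlow : max 0 (1 / 2 - b) < a := max_lt (by linarith) (by linarith)
  have hp0 : 0 ≤ p := by
    have : 0 ≤ max 0 (1 / 2 - b) := le_max_left _ _
    rw [hp]; linarith
  have hpa : p < a := by rw [hp]; linarith
  have hpb : 1 / 2 - p < b := by
    have : 1 / 2 - b ≤ max 0 (1 / 2 - b) := le_max_right _ _
    rw [hp]; linarith
  have hp'0 : 0 ≤ 1 / 2 - p := by linarith
  have hZ := ha p hp0 hpa
  have hX := hb (1 / 2 - p) hp'0 hpb
  have hsum : Tendsto (fun i => zOptimalFailureFamily C i p + xOptimalFailureFamily C i (1 / 2 - p)) atTop (𝓝 0) := by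
    simpa using hZ.add hX
  refine not_belowThreshold_of_le (P := fun i q => zOptimalFailureFamily C i q + xOptimalFailureFamily C i (1 / 2 - q))
    (p := p) (c := 1 / 2) (by norm_num) (fun i => ?_) hsum
  exact (C i).half_le_zOptimalFailure_add_xOptimalFailure (hk i) hp0 hp'0 (by ring)

/-- Accuracy-threshold form: `p_c^{Z,opt} + p_c^{X,opt} ≤ 1/2` for every CSS family with `k ≥ 1`.
[cite: RichardsonUrbanke2008, Lemma 4.78; StaceBarrettDoherty2009, p. 2 (no-cloning bound)] -/
theorem optimal_accuracyThresholds_add_le_half [∀ i, Fintype (RX i)] [∀ i, Fintype (RZ i)]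
    (C : ∀ i, CSSCode (RX i) (RZ i) (Q i)) (hk : ∀ i, 0 < (C i).k) :
    accuracyThreshold (zOptimalFailureFamily C) + accuracyThreshold (xOptimalFailureFamily C) ≤ 1 / 2 :=
  optimal_thresholds_add_le_half C hk (isThresholdLowerBound_accuracyThreshold _)
    (isThresholdLowerBound_accuracyThreshold _)

/-- **Sector-symmetric families: `p_c^{opt} ≤ 1/4`.** If the two optimal sector families coincide (e.g. the `X ↔ Z`
exchange is a re-indexing of each code), every certified optimal threshold lower bound is `≤ 1/4`.
[cite: RichardsonUrbanke2008, Lemma 4.78; StaceBarrettDoherty2009, p. 2] -/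
theorem optimal_threshold_le_quarter_of_symm [∀ i, Fintype (RX i)] [∀ i, Fintype (RZ i)]
    (C : ∀ i, CSSCode (RX i) (RZ i) (Q i)) (hk : ∀ i, 0 < (C i).k)
    (hsymm : xOptimalFailureFamily C = zOptimalFailureFamily C) {a : ℝ}
    (ha : IsThresholdLowerBound (zOptimalFailureFamily C) a) : a ≤ 1 / 4 := by
  have h := optimal_thresholds_add_le_half C hk ha (hsymm ▸ ha)
  linarith

/-- **Erasures vs flips at the optimum, finite size**: `P^Z_{2p}[erasure uncorrectable] ≤ 2 · zOptimalFailureFamily C i p`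
(`0 ≤ p ≤ 1/2`): below the optimal flip threshold, erasures at twice the rate are correctable.
[cite: RichardsonUrbanke2008, Lemma 4.78 (Erasure Decomposition Lemma)] -/
theorem zErasureFamily_two_mul_le_optimal [∀ i, Fintype (RZ i)] (C : ∀ i, CSSCode (RX i) (RZ i) (Q i)) (i : ℕ)
    {p : ℝ} (hp0 : 0 ≤ p) (hp : p ≤ 1 / 2) :
    zErasureFamily C i (2 * p) ≤ 2 * zOptimalFailureFamily C i p :=
  (C i).zUncorrectableProb_le_two_mul_zOptimalFailure hp0 hp

/-- **`2 · p₀^{Z,opt} ≤ y₀^Z`**: a certified optimal flip-threshold lower bound `a ≤ 1/2` certifies the erasure-threshold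
lower bound `2a` for the same sector. [cite: RichardsonUrbanke2008, Lemma 4.78 (Erasure Decomposition Lemma)] -/
theorem z_erasure_isThresholdLowerBound_two_mul [∀ i, Fintype (RZ i)] (C : ∀ i, CSSCode (RX i) (RZ i) (Q i))
    {a : ℝ} (ha : IsThresholdLowerBound (zOptimalFailureFamily C) a) (ha2 : a ≤ 1 / 2) :
    IsThresholdLowerBound (zErasureFamily C) (2 * a) := by
  intro y hy0 hya
  have hp0 : 0 ≤ y / 2 := by linarith
  have hpa : y / 2 < a := by linarith
  have h0 : Tendsto (fun i => zOptimalFailureFamily C i (y / 2)) atTop (𝓝 0) := ha (y / 2) hp0 hpa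
  have h := h0.const_mul 2
  rw [mul_zero] at h
  refine BelowThreshold.of_le (Q := fun i q => 2 * zOptimalFailureFamily C i (q / 2)) h (fun i => ?_) fun i => ?_
  · exact ErasureDecoder.uncorrectableProb_nonneg _ _ hy0 (by linarith : y ≤ 1)
  · have := zErasureFamily_two_mul_le_optimal C i hp0 (by linarith)
    rwa [show 2 * (y / 2) = y by ring] at this

/-- **The optimal `Z`-family is non-decreasing in the rate on `[0, 1/2]`** (degradation of the bit-flip family).
[cite: RichardsonUrbanke2008, Example 4.71 (the family {BSC(ε)} is ordered by degradation)] -/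
theorem zOptimalFailureFamily_mono [∀ i, Fintype (RZ i)] (C : ∀ i, CSSCode (RX i) (RZ i) (Q i)) (i : ℕ)
    {p p' : ℝ} (hpp' : p ≤ p') (hp' : p' ≤ 1 / 2) :
    zOptimalFailureFamily C i p ≤ zOptimalFailureFamily C i p' :=
  (C i).zOptimalFailure_mono hpp' hp'

/-- **The optimal `X`-family is non-decreasing in the rate on `[0, 1/2]`.**
[cite: RichardsonUrbanke2008, Example 4.71 (the family {BSC(ε)} is ordered by degradation)] -/
theorem xOptimalFailureFamily_mono [∀ i, Fintype (RX i)] (C : ∀ i, CSSCode (RX i) (RZ i) (Q i)) (i : ℕ)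
    {p p' : ℝ} (hpp' : p ≤ p') (hp' : p' ≤ 1 / 2) :
    xOptimalFailureFamily C i p ≤ xOptimalFailureFamily C i p' :=
  (C i).xOptimalFailure_mono hpp' hp'

/-- **Below-threshold rates of the optimal decoder form an initial segment** (`Z`-sector): if `p' ≤ 1/2` is below
threshold then so is every `0 ≤ p ≤ p'`. [cite: DennisEtAl2002, §4.3 (below threshold) with RichardsonUrbanke2008, Example 4.71] -/
theorem z_optimal_belowThreshold_of_le [∀ i, Fintype (RZ i)] (C : ∀ i, CSSCode (RX i) (RZ i) (Q i)) {p p' : ℝ}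
    (h : BelowThreshold (zOptimalFailureFamily C) p') (hp0 : 0 ≤ p) (hpp' : p ≤ p') (hp' : p' ≤ 1 / 2) :
    BelowThreshold (zOptimalFailureFamily C) p :=
  BelowThreshold.of_le (Q := fun i _ => zOptimalFailureFamily C i p') h
    (fun i => (C i).zOptimalFailure_nonneg hp0 (by linarith)) fun i => zOptimalFailureFamily_mono C i hpp' hp'

/-- **A below-threshold rate bounds the optimal accuracy threshold from below** (`Z`-sector): if `0 ≤ p' ≤ 1/2` is
below threshold for the optimal family then `p' ≤ accuracyThreshold (zOptimalFailureFamily C)` — for the optimal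
decoder DKLP's `p_c` is a threshold in the strict sense. [cite: DennisEtAl2002, §4.3 and §4.6 (p_c)] -/
theorem z_optimal_le_accuracyThreshold_of_belowThreshold [∀ i, Fintype (RZ i)] (C : ∀ i, CSSCode (RX i) (RZ i) (Q i))
    {p' : ℝ} (hp' : p' ≤ 1 / 2) (h : BelowThreshold (zOptimalFailureFamily C) p') :
    p' ≤ accuracyThreshold (zOptimalFailureFamily C) :=
  le_accuracyThreshold (fun p hp0 hpp' => z_optimal_belowThreshold_of_le C h hp0 hpp'.le hp') (by linarith)

/-- `X`-sector twin: a below-threshold rate `p' ≤ 1/2` of the optimal family is `≤` its accuracy threshold.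
[cite: DennisEtAl2002, §4.3 and §4.6 (p_c)] -/
theorem x_optimal_le_accuracyThreshold_of_belowThreshold [∀ i, Fintype (RX i)] (C : ∀ i, CSSCode (RX i) (RZ i) (Q i))
    {p' : ℝ} (hp' : p' ≤ 1 / 2) (h : BelowThreshold (xOptimalFailureFamily C) p') :
    p' ≤ accuracyThreshold (xOptimalFailureFamily C) :=
  le_accuracyThreshold
    (fun p hp0 hpp' => BelowThreshold.of_le (Q := fun i _ => xOptimalFailureFamily C i p') h
      (fun i => (C i).xOptimalFailure_nonneg hp0 (by linarith)) fun i => xOptimalFailureFamily_mono C i hpp'.le hp')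
    (by linarith)

end CSSFamilies


end Summit.Ventures.QEC.Thresholds
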